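import Summits.QuantumFields.BalabanUV.Beta.GAN24.CapacitanceEndpoint
import Summits.QuantumFields.BalabanUV.Beta.GAN24.ReadingWeightCrossSums
import Summits.QuantumFields.BalabanUV.Beta.GAN24.FieldBlockResponse

/-!
# `BalabanUV.Beta.GAN24.ForceSourceBounds` — binder row G-an2-4 / (CONV-C), road P1-fibre, leaf **P1-L09** `FibreUniformBound`, part H1 (a), file 1/2
# (and the analytic content of part H3): the CAPACITANCE RIGHT-HAND SIDES of the unit FORCE source `f̂ = fhatF N M p l y′` on the punctured real zone

NOT IN PRINT; OUR PROOF ATTEMPT.  HONEST FRAMING (cell contract, verbatim): «discharging `BetaPertH` makes Bałaban's UV stability UNCONDITIONAL — a real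
constructive-QFT result; it is NOT the continuum limit and NOT the Clay problem.»  HONEST DEPENDENCY (verbatim): «continuum YM on T⁴ ⇐ BetaPertH ∧ nine spine
estimates (0/9 proved); BetaPertH ⇐ (D1) ∧ (D4) ∧ CAP+tail; G-an2-4 gates asym, D1 and NE2/3/4.»  [folklore] bookkeeping over LANDED inputs BY NAME — leaf-12's
zero-alias Jordan bounds (`CapacitanceScalarBounds.le_sq_mul_lapR_zero`), my lineage's cross sums (`ReadingWeightCrossSums.offZero_SsAl_srcW_sum_le`, the
`three_halves` engine) and typer row P1-Y09b (`ReadingWeightSums`); no new estimate idea, no cited fact, no wall binder, no `def`.  NOT summit progress; nothing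
of (CONV-C)'s K-slot `GAN24.CombesThomas.ConvCK 3 Lc` is discharged here; 0 wall binders instantiated; NOT `BetaPertH`, NOT continuum, NOT Clay.

## Setting (currency of typer row P1-T00 `GAN24/AliasObjects`; nothing re-defined)
`D N M : ℕ`, `0 < M ≤ N` (`N = M·Lc` downstream), real Brillouin momentum `q ∈ [−π, π]^D ∖ {0}`, `p = ofRealVec q`, `|q|² = momSq q`; the unit FORCE source of the
field leg `(l, y′)` in alias amplitudes `f̂ = fhatF N M p l y′` (`f̂(m) = srcW(m, l, y′)·e_l`) with NO constraint source (`ĉ = 0`); `r := N/M`, `C := aliasWtConst D`.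

## What is proved
* §1 the source: `norm_fhatF_le`, `dot_fhatF`, and the transverse-projection bound `‖(Π⊥_m f̂(m))_κ‖ ≤ 2‖srcW(m)‖` (`norm_piPerp_fhatF_le`; `‖∂_κ‖‖∂♭_l‖ ≤ ‖L_m‖` at real `p`);
  elementary size facts at real momentum: `‖S(m)‖ ≤ N^D`, `‖s_κ(m)‖ ≤ N`, `‖srcW(m)‖ = ‖N^D srcW(m)‖/N^D ≤ 1/N^D`, and the ZERO-ALIAS denominators
  `1/‖L_0‖ ≤ π²N²/(4|q|²)`, `1/√‖L_0‖ ≤ πN/(2√|q|²)` (Jordan, leaf-12 BY NAME).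
* §2 the capacitance right-hand sides of `f̂` (`ĉ = 0`):
  **`momSq_mul_sum_norm_srcPhi_le`**: `|q|² · Σ_κ ‖srcPhi N p f̂ 0 κ‖ ≤ D·N³·(π²/4 + |q|²·r^{D+1}·C)`;
  **`momSq32_mul_norm_srcC_le`**:     `|q|²√|q|² · ‖srcC N p f̂‖ ≤ N³·(π³/8 + |q|²√|q|²·r^{D+1}·C/2)`
  (zero alias by Jordan — it carries the `1/|q|²`, `1/|q|³` poles that the capacitance orders `|q|²`, `|q|³` of row L08 absorb; nonzero aliases by the cross sums).
File 2/2 `GAN24/ForceSourceFeedback` feeds these into leaf-20's `CapacitanceEndpoint.norm_phiSol_le/norm_cSol_le`: `‖φ‖, ‖c‖ = O(N^{−(D+1)})`.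
Unit `b2b-balaban-gan24-formalise-leaf-03` (G-an2-4 formalisation swarm, leaf prover 03, gen 6), 2026-08-20.
-/


noncomputable section

open Complex Finset
open scoped BigOperators Real ComplexConjugate

namespace Summit.QuantumFields.BalabanUV.Beta.GAN24.ForceSourceBounds

open Literature.Probability.LatticeModels (TorusSite)
open Literature.MathematicalPhysics.QuantumFieldTheory.Balaban1983to89.B4Strip (ofRealVec)
open Literature.MathematicalPhysics.QuantumFieldTheory.King1986 (momSq momSq_nonneg momSq_le_card_mul_pi_sq)
open AliasWeights (sinWt kfine sinWt_pos sinWt_le_one)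
open AliasWeightsSum (lapR lapR_nonneg aliasWtConst)
open FibreBlockSolve (dot)
open AliasObjects (SAl sAl sbAl chiAl dAl dbAl LAl piPerp reg reg_eq_univ srcW readW srcPhi srcC phiSol cSol fhatF conj_ofRealVec dbAl_eq_conj)
open CapacitanceScalarBounds (momSq_pos le_sq_mul_lapR_zero lapR_zero_pos)
open CapacitanceScalarDictionary (LAl_ofRealVec_ne_zero)
open ReadingWeightSums (norm_srcW_le_one)
open ReadingWeightCrossSums (norm_LAl_ofRealVec norm_LAl_mul_sqrt_eq norm_natPow_mul_srcW_eq norm_SAl_sq_le norm_sAl_sq_le_sq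
  norm_natPow_mul_srcW_sq_le_prod offZero_SsAl_srcW_sum_le offZero_weighted_sum_three_halves_le prod_sinWt_nonneg)
open CapacitanceEndpointBlocks (cPP cPc ccc cPP_pos cPc_pos ccc_pos)
open CapacitanceEndpoint (norm_phiSol_le norm_cSol_le)

variable {D N : ℕ} [NeZero N]

/-! ## §1 The unit force source and elementary sizes at real momentum -/

/-- [folklore] Unfolding: `f̂(m)_κ = srcW(m, l, y′)` if `κ = l`, else `0`. -/
theorem fhatF_apply (M : ℕ) (p : Fin D → ℂ) (l : Fin D) (y' : Fin D → ℤ) (m : TorusSite D N) (κ : Fin D) :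
    fhatF N M p l y' m κ = if κ = l then srcW N M p m l y' else 0 := rfl

/-- [folklore] `‖f̂(m)_κ‖ ≤ ‖srcW(m, l, y′)‖`. -/
theorem norm_fhatF_le (M : ℕ) (p : Fin D → ℂ) (l : Fin D) (y' : Fin D → ℤ) (m : TorusSite D N) (κ : Fin D) :
    ‖fhatF N M p l y' m κ‖ ≤ ‖srcW N M p m l y'‖ := by
  rw [fhatF_apply]
  split_ifs
  · exact le_rfl
  · rw [norm_zero]; exact norm_nonneg _

/-- [folklore] `u · f̂(m) = u_l · srcW(m, l, y′)`. -/
theorem dot_fhatF (M : ℕ) (p : Fin D → ℂ) (l : Fin D) (y' : Fin D → ℤ) (m : TorusSite D N) (u : Fin D → ℂ) :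
    dot u (fhatF N M p l y' m) = u l * srcW N M p m l y' := by
  unfold dot
  simp only [fhatF_apply, mul_ite, mul_zero]
  rw [Finset.sum_ite_eq' Finset.univ l]
  simp

/-- [folklore] **TRANSVERSE PROJECTION OF THE FORCE SOURCE** at real momentum, any class with `L_m ≠ 0`:
`‖(Π⊥_m f̂(m))_κ‖ ≤ 2·‖srcW(m, l, y′)‖` (`‖∂_{mκ}‖·‖∂♭_{ml}‖ ≤ ‖L_m‖`, both factors `≤ √‖L_m‖` by `FieldBlockResponse.norm_dAl_le_sqrt`). -/
theorem norm_piPerp_fhatF_le (M : ℕ) {q : Fin D → ℝ} {m : TorusSite D N} (hL : LAl N (ofRealVec q) m ≠ 0)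
    (l : Fin D) (y' : Fin D → ℤ) (κ : Fin D) :
    ‖piPerp (dAl N (ofRealVec q) m) (dbAl N (ofRealVec q) m) (LAl N (ofRealVec q) m) (fhatF N M (ofRealVec q) l y' m) κ‖
      ≤ 2 * ‖srcW N M (ofRealVec q) m l y'‖ := by
  have hp : ∀ μ, conj (ofRealVec q μ) = ofRealVec q μ := conj_ofRealVec q
  have hLpos : 0 < ‖LAl N (ofRealVec q) m‖ := norm_pos_iff.2 hL
  have hd : ‖dAl N (ofRealVec q) m κ‖ ≤ Real.sqrt ‖LAl N (ofRealVec q) m‖ := FieldBlockResponse.norm_dAl_le_sqrt hp m κ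
  have hdb : ‖dbAl N (ofRealVec q) m l‖ ≤ Real.sqrt ‖LAl N (ofRealVec q) m‖ := by
    rw [dbAl_eq_conj hp m l, Complex.norm_conj]
    exact FieldBlockResponse.norm_dAl_le_sqrt hp m l
  set w := ‖srcW N M (ofRealVec q) m l y'‖ with hw
  have h1 : ‖fhatF N M (ofRealVec q) l y' m κ‖ ≤ w := norm_fhatF_le M _ l y' m κ
  have hprod : ‖dAl N (ofRealVec q) m κ‖ * ‖dbAl N (ofRealVec q) m l‖ ≤ ‖LAl N (ofRealVec q) m‖ := by
    calc ‖dAl N (ofRealVec q) m κ‖ * ‖dbAl N (ofRealVec q) m l‖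
        ≤ Real.sqrt ‖LAl N (ofRealVec q) m‖ * Real.sqrt ‖LAl N (ofRealVec q) m‖ :=
          mul_le_mul hd hdb (norm_nonneg _) (Real.sqrt_nonneg _)
      _ = ‖LAl N (ofRealVec q) m‖ := Real.mul_self_sqrt hLpos.le
  have h2 : ‖dAl N (ofRealVec q) m κ * dot (dbAl N (ofRealVec q) m) (fhatF N M (ofRealVec q) l y' m) / LAl N (ofRealVec q) m‖ ≤ w := by
    rw [dot_fhatF, norm_div, norm_mul, norm_mul, div_le_iff₀ hLpos]
    calc ‖dAl N (ofRealVec q) m κ‖ * (‖dbAl N (ofRealVec q) m l‖ * ‖srcW N M (ofRealVec q) m l y'‖)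
        = (‖dAl N (ofRealVec q) m κ‖ * ‖dbAl N (ofRealVec q) m l‖) * w := by rw [hw]; ring
      _ ≤ ‖LAl N (ofRealVec q) m‖ * w := mul_le_mul_of_nonneg_right hprod (norm_nonneg _)
      _ = w * ‖LAl N (ofRealVec q) m‖ := mul_comm _ _
  unfold piPerp
  calc ‖fhatF N M (ofRealVec q) l y' m κ -
          dAl N (ofRealVec q) m κ * dot (dbAl N (ofRealVec q) m) (fhatF N M (ofRealVec q) l y' m) / LAl N (ofRealVec q) m‖
      ≤ ‖fhatF N M (ofRealVec q) l y' m κ‖ +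
          ‖dAl N (ofRealVec q) m κ * dot (dbAl N (ofRealVec q) m) (fhatF N M (ofRealVec q) l y' m) / LAl N (ofRealVec q) m‖ :=
        norm_sub_le _ _
    _ ≤ w + w := add_le_add h1 h2
    _ = 2 * w := by ring

/-- [folklore] `‖S(m)‖ ≤ N^D` at real momentum. -/
theorem norm_SAl_le (q : Fin D → ℝ) (m : TorusSite D N) : ‖SAl N (ofRealVec q) m‖ ≤ (N : ℝ) ^ D := by
  have h := norm_SAl_sq_le (N := N) q m
  have h1 : ‖SAl N (ofRealVec q) m‖ ^ 2 ≤ ((N : ℝ) ^ D) ^ 2 := by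
    calc ‖SAl N (ofRealVec q) m‖ ^ 2 ≤ ((N : ℝ) ^ 2) ^ D * ∏ i, sinWt N (kfine N q m i) := h
      _ ≤ ((N : ℝ) ^ 2) ^ D * 1 := mul_le_mul_of_nonneg_left
          (Finset.prod_le_one (fun i _ => (sinWt_pos _ _).le) fun i _ => sinWt_le_one _ _) (by positivity)
      _ = ((N : ℝ) ^ D) ^ 2 := by rw [mul_one, ← pow_mul, ← pow_mul, mul_comm]
  exact (pow_le_pow_iff_left₀ (norm_nonneg _) (by positivity) two_ne_zero).1 h1

/-- [folklore] `‖s_κ(m)‖ ≤ N` at real momentum. -/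
theorem norm_sAl_le (q : Fin D → ℝ) (m : TorusSite D N) (κ : Fin D) : ‖sAl N (ofRealVec q) m κ‖ ≤ N :=
  (pow_le_pow_iff_left₀ (norm_nonneg _) (Nat.cast_nonneg N) two_ne_zero).1 (norm_sAl_sq_le_sq q m κ)

/-- [folklore] `‖srcW(m)‖ = ‖N^D·srcW(m)‖ / N^D`. -/
theorem norm_srcW_eq (M : ℕ) (q : Fin D → ℝ) (m : TorusSite D N) (l : Fin D) (y' : Fin D → ℤ) :
    ‖srcW N M (ofRealVec q) m l y'‖ = ‖(N : ℂ) ^ D * srcW N M (ofRealVec q) m l y'‖ / (N : ℝ) ^ D := by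
  have hN : (0 : ℝ) < (N : ℝ) ^ D := pow_pos (Nat.cast_pos.2 (Nat.pos_of_ne_zero (NeZero.ne N))) D
  rw [norm_mul, norm_pow, Complex.norm_natCast, eq_div_iff hN.ne', mul_comm]

/-- [folklore] `‖srcW(m)‖ ≤ 1/N^D` at real momentum (`0 < M`; typer row P1-Y09b's `norm_srcW_le_one`). -/
theorem norm_srcW_le {M : ℕ} (hM : 0 < M) (q : Fin D → ℝ) (m : TorusSite D N) (l : Fin D) (y' : Fin D → ℤ) :
    ‖srcW N M (ofRealVec q) m l y'‖ ≤ 1 / (N : ℝ) ^ D := by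
  rw [norm_srcW_eq]
  exact div_le_div_of_nonneg_right (norm_srcW_le_one hM q m l y') (by positivity)

/-- [folklore] **ZERO-ALIAS DENOMINATOR** (Jordan, leaf-12 `le_sq_mul_lapR_zero` BY NAME): `1/‖L_0‖ ≤ π²N²/(4|q|²)` for `q ∈ [−π, π]^D ∖ {0}`, `N ≥ 1`. -/
theorem inv_norm_LAl_zero_le (hN : 1 ≤ N) {q : Fin D → ℝ} (hq : ∀ i, |q i| ≤ π) (hq0 : q ≠ 0) :
    1 / ‖LAl N (ofRealVec q) 0‖ ≤ π ^ 2 * (N : ℝ) ^ 2 / (4 * momSq q) := by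
  have hμ : 0 < momSq q := momSq_pos hq0
  have hL : 0 < ‖LAl N (ofRealVec q) 0‖ := by rw [norm_LAl_ofRealVec]; exact lapR_zero_pos hN hq hq0
  have h := le_sq_mul_lapR_zero hN hq (N := N)
  rw [norm_LAl_ofRealVec] at hL ⊢
  rw [div_le_div_iff₀ hL (by positivity)]
  have hπ : 0 < π ^ 2 := by positivity
  calc 1 * (4 * momSq q) = π ^ 2 * (4 / π ^ 2 * momSq q) := by field_simp
    _ ≤ π ^ 2 * ((N : ℝ) ^ 2 * lapR (kfine N q 0)) := mul_le_mul_of_nonneg_left h hπ.le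
    _ = π ^ 2 * (N : ℝ) ^ 2 * lapR (kfine N q 0) := by ring

/-- [folklore] … and its square-root form `1/√‖L_0‖ ≤ πN/(2√|q|²)`. -/
theorem inv_sqrt_norm_LAl_zero_le (hN : 1 ≤ N) {q : Fin D → ℝ} (hq : ∀ i, |q i| ≤ π) (hq0 : q ≠ 0) :
    1 / Real.sqrt ‖LAl N (ofRealVec q) 0‖ ≤ π * N / (2 * Real.sqrt (momSq q)) := by
  have hμ : 0 < momSq q := momSq_pos hq0
  have hNr : (0 : ℝ) < N := by exact_mod_cast hN
  have hL : 0 < ‖LAl N (ofRealVec q) 0‖ := by rw [norm_LAl_ofRealVec]; exact lapR_zero_pos hN hq hq0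
  -- `(2/(πN))²·|q|² ≤ ‖L_0‖`
  have hy : (2 / (π * N)) ^ 2 * momSq q ≤ ‖LAl N (ofRealVec q) 0‖ := by
    have h := le_sq_mul_lapR_zero hN hq (N := N)
    rw [norm_LAl_ofRealVec]
    have hπN : 0 < (π * N) ^ 2 := by positivity
    rw [div_pow, div_mul_eq_mul_div, div_le_iff₀ hπN]
    calc 2 ^ 2 * momSq q = π ^ 2 * (4 / π ^ 2 * momSq q) := by field_simp; ring
      _ ≤ π ^ 2 * ((N : ℝ) ^ 2 * lapR (kfine N q 0)) := mul_le_mul_of_nonneg_left h (by positivity)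
      _ = lapR (kfine N q 0) * (π * N) ^ 2 := by ring
  have hsy : Real.sqrt ((2 / (π * N)) ^ 2 * momSq q) = 2 / (π * N) * Real.sqrt (momSq q) := by
    rw [Real.sqrt_mul (sq_nonneg _), Real.sqrt_sq (by positivity)]
  have hpos : 0 < 2 / (π * N) * Real.sqrt (momSq q) := by positivity
  calc 1 / Real.sqrt ‖LAl N (ofRealVec q) 0‖ ≤ 1 / Real.sqrt ((2 / (π * N)) ^ 2 * momSq q) :=
        one_div_le_one_div_of_le (by rw [hsy]; exact hpos) (Real.sqrt_le_sqrt hy)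
    _ = π * N / (2 * Real.sqrt (momSq q)) := by
        rw [hsy]
        field_simp

/-! ## §2 The capacitance right-hand sides of the force source -/

/-- [folklore] Per component: `‖srcPhi N p f̂ 0 κ‖ ≤ Σ_m ‖S(m)‖·‖s_κ(m)‖·‖srcW(m)‖/‖L_m‖` (every class regular on the punctured real zone; `Π⊥` bound of §1). -/
theorem norm_srcPhi_fhatF_le (hN : 1 ≤ N) (M : ℕ) {q : Fin D → ℝ} (hq : ∀ i, |q i| ≤ π) (hq0 : q ≠ 0) (l : Fin D) (y' : Fin D → ℤ)
    (κ : Fin D) :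
    ‖srcPhi N (ofRealVec q) (fhatF N M (ofRealVec q) l y') 0 κ‖
      ≤ ∑ m, ‖SAl N (ofRealVec q) m‖ * ‖sAl N (ofRealVec q) m κ‖ * ‖srcW N M (ofRealVec q) m l y'‖ / ‖LAl N (ofRealVec q) m‖ := by
  have h := LAl_ofRealVec_ne_zero hN hq hq0 (N := N)
  unfold srcPhi
  rw [reg_eq_univ N (ofRealVec q) h, Pi.zero_apply, zero_sub, norm_neg]
  refine (norm_sum_le _ _).trans (Finset.sum_le_sum fun m _ => ?_)
  have hL : 0 < ‖LAl N (ofRealVec q) m‖ := norm_pos_iff.2 (h m)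
  rw [norm_mul, norm_mul, norm_div, norm_mul, Complex.norm_two]
  calc ‖SAl N (ofRealVec q) m‖ / (2 * ‖LAl N (ofRealVec q) m‖) * ‖sAl N (ofRealVec q) m κ‖ *
        ‖piPerp (dAl N (ofRealVec q) m) (dbAl N (ofRealVec q) m) (LAl N (ofRealVec q) m) (fhatF N M (ofRealVec q) l y' m) κ‖
      ≤ ‖SAl N (ofRealVec q) m‖ / (2 * ‖LAl N (ofRealVec q) m‖) * ‖sAl N (ofRealVec q) m κ‖ * (2 * ‖srcW N M (ofRealVec q) m l y'‖) :=
        mul_le_mul_of_nonneg_left (norm_piPerp_fhatF_le M (h m) l y' κ) (by positivity)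
    _ = ‖SAl N (ofRealVec q) m‖ * ‖sAl N (ofRealVec q) m κ‖ * ‖srcW N M (ofRealVec q) m l y'‖ / ‖LAl N (ofRealVec q) m‖ := by
        field_simp

/-- [folklore] `‖srcC N p f̂‖ ≤ Σ_m ‖S(m)‖·‖srcW(m)‖/(‖L_m‖√‖L_m‖)` (`‖∂♭_{ml}‖ ≤ √‖L_m‖`). -/
theorem norm_srcC_fhatF_le (hN : 1 ≤ N) (M : ℕ) {q : Fin D → ℝ} (hq : ∀ i, |q i| ≤ π) (hq0 : q ≠ 0) (l : Fin D) (y' : Fin D → ℤ) :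
    ‖srcC N (ofRealVec q) (fhatF N M (ofRealVec q) l y')‖
      ≤ ∑ m, ‖SAl N (ofRealVec q) m‖ * ‖srcW N M (ofRealVec q) m l y'‖ / (‖LAl N (ofRealVec q) m‖ * Real.sqrt ‖LAl N (ofRealVec q) m‖) := by
  have hp : ∀ μ, conj (ofRealVec q μ) = ofRealVec q μ := conj_ofRealVec q
  have h := LAl_ofRealVec_ne_zero hN hq hq0 (N := N)
  unfold srcC
  rw [reg_eq_univ N (ofRealVec q) h, norm_neg]
  refine (norm_sum_le _ _).trans (Finset.sum_le_sum fun m _ => ?_)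
  have hL : 0 < ‖LAl N (ofRealVec q) m‖ := norm_pos_iff.2 (h m)
  have hs : 0 < Real.sqrt ‖LAl N (ofRealVec q) m‖ := Real.sqrt_pos.2 hL
  have hdb : ‖dbAl N (ofRealVec q) m l‖ ≤ Real.sqrt ‖LAl N (ofRealVec q) m‖ := by
    rw [dbAl_eq_conj hp m l, Complex.norm_conj]
    exact FieldBlockResponse.norm_dAl_le_sqrt hp m l
  rw [norm_div, norm_mul, dot_fhatF, norm_mul, norm_pow]
  rw [div_le_div_iff₀ (by positivity) (by positivity)]
  have hsq : Real.sqrt ‖LAl N (ofRealVec q) m‖ * Real.sqrt ‖LAl N (ofRealVec q) m‖ = ‖LAl N (ofRealVec q) m‖ := Real.mul_self_sqrt hL.le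
  calc ‖SAl N (ofRealVec q) m‖ * (‖dbAl N (ofRealVec q) m l‖ * ‖srcW N M (ofRealVec q) m l y'‖) *
        (‖LAl N (ofRealVec q) m‖ * Real.sqrt ‖LAl N (ofRealVec q) m‖)
      ≤ ‖SAl N (ofRealVec q) m‖ * (Real.sqrt ‖LAl N (ofRealVec q) m‖ * ‖srcW N M (ofRealVec q) m l y'‖) *
        (‖LAl N (ofRealVec q) m‖ * Real.sqrt ‖LAl N (ofRealVec q) m‖) := by gcongr
    _ = ‖SAl N (ofRealVec q) m‖ * ‖srcW N M (ofRealVec q) m l y'‖ *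
        (‖LAl N (ofRealVec q) m‖ * (Real.sqrt ‖LAl N (ofRealVec q) m‖ * Real.sqrt ‖LAl N (ofRealVec q) m‖)) := by ring
    _ = ‖SAl N (ofRealVec q) m‖ * ‖srcW N M (ofRealVec q) m l y'‖ * ‖LAl N (ofRealVec q) m‖ ^ 2 := by rw [hsq]; ring

/-- [folklore] Splitting a sum over the alias classes into the zero class and the rest. -/
theorem sum_eq_zero_add_sum_erase (f : TorusSite D N → ℝ) :
    ∑ m, f m = f 0 + ∑ m ∈ (Finset.univ : Finset (TorusSite D N)).erase 0, f m :=
  (Finset.add_sum_erase _ f (Finset.mem_univ _)).symm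

section Sums

variable {M : ℕ} (hN : 1 ≤ N) (hM : 0 < M) (hMN : M ≤ N) {q : Fin D → ℝ} (hq : ∀ i, |q i| ≤ π) (hq0 : q ≠ 0)
include hN hM hMN hq hq0

/-- [folklore] **THE `φ` RIGHT-HAND SIDE OF THE FORCE SOURCE**: `|q|² · Σ_κ ‖srcPhi N p f̂ 0 κ‖ ≤ D·N³·(π²/4 + |q|²·(N/M)^{D+1}·aliasWtConst D)`
(zero alias: `‖S(0)‖‖s_κ(0)‖ ≤ N^{D+1}`, `‖srcW(0)‖ ≤ N^{−D}`, `1/‖L_0‖ ≤ π²N²/(4|q|²)`; nonzero aliases: `ReadingWeightCrossSums.offZero_SsAl_srcW_sum_le` × `N²/N^D`). -/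
theorem momSq_mul_sum_norm_srcPhi_le (l : Fin D) (y' : Fin D → ℤ) :
    momSq q * ∑ κ, ‖srcPhi N (ofRealVec q) (fhatF N M (ofRealVec q) l y') 0 κ‖
      ≤ D * ((N : ℝ) ^ 3 * (π ^ 2 / 4 + momSq q * ((N : ℝ) / M) ^ (D + 1) * aliasWtConst D)) := by
  have hμ : 0 < momSq q := momSq_pos hq0
  have hNr : (0 : ℝ) < N := by exact_mod_cast hN
  have hND : (0 : ℝ) < (N : ℝ) ^ D := pow_pos hNr D
  have h := LAl_ofRealVec_ne_zero hN hq hq0 (N := N)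
  -- per component
  have hκ : ∀ κ, momSq q * ‖srcPhi N (ofRealVec q) (fhatF N M (ofRealVec q) l y') 0 κ‖
      ≤ (N : ℝ) ^ 3 * (π ^ 2 / 4 + momSq q * ((N : ℝ) / M) ^ (D + 1) * aliasWtConst D) := by
    intro κ
    have h1 := norm_srcPhi_fhatF_le hN M hq hq0 l y' κ
    rw [sum_eq_zero_add_sum_erase] at h1
    -- zero class
    have hz : ‖SAl N (ofRealVec q) 0‖ * ‖sAl N (ofRealVec q) 0 κ‖ * ‖srcW N M (ofRealVec q) 0 l y'‖ / ‖LAl N (ofRealVec q) 0‖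
        ≤ (N : ℝ) ^ 3 * (π ^ 2 / (4 * momSq q)) := by
      have hL0 : 0 < ‖LAl N (ofRealVec q) 0‖ := norm_pos_iff.2 (h 0)
      have hnum : ‖SAl N (ofRealVec q) 0‖ * ‖sAl N (ofRealVec q) 0 κ‖ * ‖srcW N M (ofRealVec q) 0 l y'‖ ≤ (N : ℝ) ^ D * N * (1 / (N : ℝ) ^ D) :=
        mul_le_mul (mul_le_mul (norm_SAl_le q 0) (norm_sAl_le q 0 κ) (norm_nonneg _) (by positivity)) (norm_srcW_le hM q 0 l y')
          (norm_nonneg _) (by positivity)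
      have hNe : (N : ℝ) ^ D * N * (1 / (N : ℝ) ^ D) = N := by field_simp
      rw [hNe] at hnum
      calc ‖SAl N (ofRealVec q) 0‖ * ‖sAl N (ofRealVec q) 0 κ‖ * ‖srcW N M (ofRealVec q) 0 l y'‖ / ‖LAl N (ofRealVec q) 0‖
          = ‖SAl N (ofRealVec q) 0‖ * ‖sAl N (ofRealVec q) 0 κ‖ * ‖srcW N M (ofRealVec q) 0 l y'‖ * (1 / ‖LAl N (ofRealVec q) 0‖) := by
            rw [mul_one_div]
        _ ≤ N * (π ^ 2 * (N : ℝ) ^ 2 / (4 * momSq q)) :=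
            mul_le_mul hnum (inv_norm_LAl_zero_le hN hq hq0) (by positivity) hNr.le
        _ = (N : ℝ) ^ 3 * (π ^ 2 / (4 * momSq q)) := by ring
    -- nonzero classes: rewrite each term into the cross-sum currency
    have hnz : ∑ m ∈ (Finset.univ : Finset (TorusSite D N)).erase 0,
          ‖SAl N (ofRealVec q) m‖ * ‖sAl N (ofRealVec q) m κ‖ * ‖srcW N M (ofRealVec q) m l y'‖ / ‖LAl N (ofRealVec q) m‖
        ≤ (N : ℝ) ^ 3 * (((N : ℝ) / M) ^ (D + 1) * aliasWtConst D) := by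
      have e : ∀ m ∈ (Finset.univ : Finset (TorusSite D N)).erase 0,
          ‖SAl N (ofRealVec q) m‖ * ‖sAl N (ofRealVec q) m κ‖ * ‖srcW N M (ofRealVec q) m l y'‖ / ‖LAl N (ofRealVec q) m‖
            = ((N : ℝ) ^ 2 / (N : ℝ) ^ D) *
              (‖SAl N (ofRealVec q) m‖ * ‖sAl N (ofRealVec q) m κ‖ * ‖(N : ℂ) ^ D * srcW N M (ofRealVec q) m l y'‖ /
                ((N : ℝ) ^ 2 * lapR (kfine N q m))) := by
        intro m hm
        have hLm : 0 < lapR (kfine N q m) := by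
          have := norm_pos_iff.2 (h m); rwa [norm_LAl_ofRealVec] at this
        rw [norm_srcW_eq, norm_LAl_ofRealVec]
        field_simp
      rw [Finset.sum_congr rfl e, ← Finset.mul_sum]
      calc (N : ℝ) ^ 2 / (N : ℝ) ^ D * ∑ m ∈ (Finset.univ : Finset (TorusSite D N)).erase 0,
            ‖SAl N (ofRealVec q) m‖ * ‖sAl N (ofRealVec q) m κ‖ * ‖(N : ℂ) ^ D * srcW N M (ofRealVec q) m l y'‖ /
              ((N : ℝ) ^ 2 * lapR (kfine N q m))
          ≤ (N : ℝ) ^ 2 / (N : ℝ) ^ D * ((N : ℝ) ^ (D + 1) * ((N : ℝ) / M) ^ (D + 1) * aliasWtConst D) :=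
            mul_le_mul_of_nonneg_left (offZero_SsAl_srcW_sum_le hM hMN hq κ l y') (by positivity)
        _ = (N : ℝ) ^ 3 * (((N : ℝ) / M) ^ (D + 1) * aliasWtConst D) := by
            field_simp
            ring
    calc momSq q * ‖srcPhi N (ofRealVec q) (fhatF N M (ofRealVec q) l y') 0 κ‖
        ≤ momSq q * ((N : ℝ) ^ 3 * (π ^ 2 / (4 * momSq q)) + (N : ℝ) ^ 3 * (((N : ℝ) / M) ^ (D + 1) * aliasWtConst D)) :=
          mul_le_mul_of_nonneg_left (h1.trans (add_le_add hz hnz)) hμ.le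
      _ = (N : ℝ) ^ 3 * (π ^ 2 / 4 + momSq q * ((N : ℝ) / M) ^ (D + 1) * aliasWtConst D) := by
          field_simp
  calc momSq q * ∑ κ, ‖srcPhi N (ofRealVec q) (fhatF N M (ofRealVec q) l y') 0 κ‖
      = ∑ κ, momSq q * ‖srcPhi N (ofRealVec q) (fhatF N M (ofRealVec q) l y') 0 κ‖ := Finset.mul_sum _ _ _
    _ ≤ ∑ _κ : Fin D, (N : ℝ) ^ 3 * (π ^ 2 / 4 + momSq q * ((N : ℝ) / M) ^ (D + 1) * aliasWtConst D) := Finset.sum_le_sum fun κ _ => hκ κ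
    _ = D * ((N : ℝ) ^ 3 * (π ^ 2 / 4 + momSq q * ((N : ℝ) / M) ^ (D + 1) * aliasWtConst D)) := by
        rw [Finset.sum_const, Finset.card_univ, Fintype.card_fin, nsmul_eq_mul]

/-- [folklore] **THE `c` RIGHT-HAND SIDE OF THE FORCE SOURCE**: `|q|²√|q|² · ‖srcC N p f̂‖ ≤ N³·(π³/8 + |q|²√|q|²·(N/M)^{D+1}·aliasWtConst D/2)`
(zero alias by the two Jordan denominators of §1; nonzero aliases by the `three_halves` engine with `u = ‖S‖` (`U = N^D`), `v = ‖N^D srcW‖` (`V = (N/M)^{D+1}`) × `N³/N^D`). -/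
theorem momSq32_mul_norm_srcC_le (l : Fin D) (y' : Fin D → ℤ) :
    momSq q * Real.sqrt (momSq q) * ‖srcC N (ofRealVec q) (fhatF N M (ofRealVec q) l y')‖
      ≤ (N : ℝ) ^ 3 * (π ^ 3 / 8 + momSq q * Real.sqrt (momSq q) * ((N : ℝ) / M) ^ (D + 1) * aliasWtConst D / 2) := by
  have hμ : 0 < momSq q := momSq_pos hq0
  have hsμ : 0 < Real.sqrt (momSq q) := Real.sqrt_pos.2 hμ
  have hNr : (0 : ℝ) < N := by exact_mod_cast hN
  have hND : (0 : ℝ) < (N : ℝ) ^ D := pow_pos hNr D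
  have h := LAl_ofRealVec_ne_zero hN hq hq0 (N := N)
  have h1 := norm_srcC_fhatF_le hN M hq hq0 l y'
  rw [sum_eq_zero_add_sum_erase] at h1
  -- zero class
  have hz : ‖SAl N (ofRealVec q) 0‖ * ‖srcW N M (ofRealVec q) 0 l y'‖ / (‖LAl N (ofRealVec q) 0‖ * Real.sqrt ‖LAl N (ofRealVec q) 0‖)
      ≤ (N : ℝ) ^ 3 * (π ^ 3 / (8 * (momSq q * Real.sqrt (momSq q)))) := by
    have hL0 : 0 < ‖LAl N (ofRealVec q) 0‖ := norm_pos_iff.2 (h 0)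
    have hs0 : 0 < Real.sqrt ‖LAl N (ofRealVec q) 0‖ := Real.sqrt_pos.2 hL0
    have hnum : ‖SAl N (ofRealVec q) 0‖ * ‖srcW N M (ofRealVec q) 0 l y'‖ ≤ (N : ℝ) ^ D * (1 / (N : ℝ) ^ D) :=
      mul_le_mul (norm_SAl_le q 0) (norm_srcW_le hM q 0 l y') (norm_nonneg _) (by positivity)
    have hNe : (N : ℝ) ^ D * (1 / (N : ℝ) ^ D) = 1 := by field_simp
    rw [hNe] at hnum
    have hden : 1 / (‖LAl N (ofRealVec q) 0‖ * Real.sqrt ‖LAl N (ofRealVec q) 0‖)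
        ≤ (π ^ 2 * (N : ℝ) ^ 2 / (4 * momSq q)) * (π * N / (2 * Real.sqrt (momSq q))) := by
      rw [← one_div_mul_one_div]
      exact mul_le_mul (inv_norm_LAl_zero_le hN hq hq0) (inv_sqrt_norm_LAl_zero_le hN hq hq0) (by positivity) (by positivity)
    calc ‖SAl N (ofRealVec q) 0‖ * ‖srcW N M (ofRealVec q) 0 l y'‖ / (‖LAl N (ofRealVec q) 0‖ * Real.sqrt ‖LAl N (ofRealVec q) 0‖)
        = ‖SAl N (ofRealVec q) 0‖ * ‖srcW N M (ofRealVec q) 0 l y'‖ * (1 / (‖LAl N (ofRealVec q) 0‖ * Real.sqrt ‖LAl N (ofRealVec q) 0‖)) := by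
          rw [mul_one_div]
      _ ≤ 1 * ((π ^ 2 * (N : ℝ) ^ 2 / (4 * momSq q)) * (π * N / (2 * Real.sqrt (momSq q)))) :=
          mul_le_mul hnum hden (by positivity) zero_le_one
      _ = (N : ℝ) ^ 3 * (π ^ 3 / (8 * (momSq q * Real.sqrt (momSq q)))) := by
          field_simp
          ring
  -- nonzero classes
  have hnz : ∑ m ∈ (Finset.univ : Finset (TorusSite D N)).erase 0,
        ‖SAl N (ofRealVec q) m‖ * ‖srcW N M (ofRealVec q) m l y'‖ / (‖LAl N (ofRealVec q) m‖ * Real.sqrt ‖LAl N (ofRealVec q) m‖)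
      ≤ (N : ℝ) ^ 3 * (((N : ℝ) / M) ^ (D + 1) * aliasWtConst D / 2) := by
    have e : ∀ m ∈ (Finset.univ : Finset (TorusSite D N)).erase 0,
        ‖SAl N (ofRealVec q) m‖ * ‖srcW N M (ofRealVec q) m l y'‖ / (‖LAl N (ofRealVec q) m‖ * Real.sqrt ‖LAl N (ofRealVec q) m‖)
          = ((N : ℝ) ^ 3 / (N : ℝ) ^ D) *
            (‖SAl N (ofRealVec q) m‖ * ‖(N : ℂ) ^ D * srcW N M (ofRealVec q) m l y'‖ /
              (((N : ℝ) ^ 2 * lapR (kfine N q m)) * Real.sqrt ((N : ℝ) ^ 2 * lapR (kfine N q m)))) := by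
      intro m hm
      have hLm : 0 < lapR (kfine N q m) := by
        have := norm_pos_iff.2 (h m); rwa [norm_LAl_ofRealVec] at this
      have hsq : 0 < Real.sqrt ((N : ℝ) ^ 2 * lapR (kfine N q m)) := Real.sqrt_pos.2 (by positivity)
      rw [norm_srcW_eq, norm_LAl_mul_sqrt_eq]
      field_simp
    rw [Finset.sum_congr rfl e, ← Finset.mul_sum]
    have hU : ∀ m : TorusSite D N, ‖SAl N (ofRealVec q) m‖ ^ 2 ≤ ((N : ℝ) ^ D) ^ 2 * ∏ i, sinWt N (kfine N q m i) := by
      intro m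
      have := norm_SAl_sq_le (N := N) q m
      rwa [← pow_mul, mul_comm 2 D, pow_mul] at this
    have h3 := offZero_weighted_sum_three_halves_le (N := N) hq (fun m => ‖SAl N (ofRealVec q) m‖)
      (fun m => ‖(N : ℂ) ^ D * srcW N M (ofRealVec q) m l y'‖) (U := (N : ℝ) ^ D) (V := ((N : ℝ) / M) ^ (D + 1))
      (by positivity) (by positivity) (fun m => norm_nonneg _) (fun m => norm_nonneg _) hU
      (fun m => norm_natPow_mul_srcW_sq_le_prod hM hMN q m l y')
    calc (N : ℝ) ^ 3 / (N : ℝ) ^ D * ∑ m ∈ (Finset.univ : Finset (TorusSite D N)).erase 0,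
          ‖SAl N (ofRealVec q) m‖ * ‖(N : ℂ) ^ D * srcW N M (ofRealVec q) m l y'‖ /
            (((N : ℝ) ^ 2 * lapR (kfine N q m)) * Real.sqrt ((N : ℝ) ^ 2 * lapR (kfine N q m)))
        ≤ (N : ℝ) ^ 3 / (N : ℝ) ^ D * ((N : ℝ) ^ D * ((N : ℝ) / M) ^ (D + 1) * aliasWtConst D / 2) :=
          mul_le_mul_of_nonneg_left h3 (by positivity)
      _ = (N : ℝ) ^ 3 * (((N : ℝ) / M) ^ (D + 1) * aliasWtConst D / 2) := by
          field_simp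
  calc momSq q * Real.sqrt (momSq q) * ‖srcC N (ofRealVec q) (fhatF N M (ofRealVec q) l y')‖
      ≤ momSq q * Real.sqrt (momSq q) *
          ((N : ℝ) ^ 3 * (π ^ 3 / (8 * (momSq q * Real.sqrt (momSq q)))) + (N : ℝ) ^ 3 * (((N : ℝ) / M) ^ (D + 1) * aliasWtConst D / 2)) :=
        mul_le_mul_of_nonneg_left (h1.trans (add_le_add hz hnz)) (by positivity)
    _ = (N : ℝ) ^ 3 * (π ^ 3 / 8 + momSq q * Real.sqrt (momSq q) * ((N : ℝ) / M) ^ (D + 1) * aliasWtConst D / 2) := by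
        field_simp

end Sums

end Summit.QuantumFields.BalabanUV.Beta.GAN24.ForceSourceBounds

end
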